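import Literature.Analysis.ODE.ParametricLinear
import HarnessLib

/-!
# Transport of Cauchy data along `u'' = p u' + q u`, smoothly in parameters

Topic `Literature/Analysis/ODE` (namespace `Literature.Analysis.ODE`). For a family of scalar
linear equations `u'' = p(π, r) u' + q(π, r) u` with complex coefficients depending `Cⁿ`-smoothly
(`1 ≤ n`) on a parameter `π ∈ U ⊆ P` (real Banach space, `U` open) and on `r > ρ₀`, and two
radii `ρ₀ < r₁ < r₂`, the **transport map** `Φ(π) : ℂ² → ℂ²` taking the Cauchy datum
`(u(r₁), u'(r₁))` of any solution on `(ρ₀, ∞)` to `(u(r₂), u'(r₂))` exists, is linear in the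
datum and `Cⁿ` jointly in `(π, datum)` (`exists_transport`). Proof: Lang's parametric linear flow
(`exists_contDiffOn_linearODE_param`, time origin at the midpoint of `[r₁, r₂]` so that the
symmetric time interval stays inside `(ρ₀, ∞)`), a fundamental pair of solutions, the `2 × 2`
connection matrix (invertible by uniqueness, `eqOn_of_hasDerivAt_linear`) and Cramer's rule. This
is the "connection coefficient" step `R = A ρ₁ + B ρ₂`, `A, B` analytic, of Shlapentokh-Rothman,
CMP 329 (2014), §4.3 / App. A, in the form consumed by the mode construction. Everything is proved.

## References

* S. Lang, *Differential and Riemannian Manifolds* (1995), Ch. IV §1, Prop. 1.9, Thm. 1.16.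
  Key `Lang1995`.
* Y. Shlapentokh-Rothman, Comm. Math. Phys. 329 (2014) 859–891, §4.3, App. A. Key
  `ShlapentokhRothman2014KleinGordon`.
-/

noncomputable section

open Set Filter Metric Topology Complex
open scoped ContDiff

namespace Literature.Analysis.ODE

/-! ### The phase field of `u'' = p u' + q u` as a real continuous linear map on `ℂ²` -/

/-- The phase space `ℂ²`. [folklore] -/
abbrev W2 : Type := ℂ × ℂ

/-- `y ↦ (y₂, 0)`. [folklore] -/
def tE0 : W2 →L[ℝ] W2 := (ContinuousLinearMap.inl ℝ ℂ ℂ).comp (ContinuousLinearMap.snd ℝ ℂ ℂ)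
/-- `y ↦ (0, y₂)`. [folklore] -/
def tE1 : W2 →L[ℝ] W2 := (ContinuousLinearMap.inr ℝ ℂ ℂ).comp (ContinuousLinearMap.snd ℝ ℂ ℂ)
/-- `y ↦ (0, i y₂)`. [folklore] -/
def tE2 : W2 →L[ℝ] W2 :=
  (ContinuousLinearMap.inr ℝ ℂ ℂ).comp ((ContinuousLinearMap.mul ℝ ℂ I).comp (ContinuousLinearMap.snd ℝ ℂ ℂ))
/-- `y ↦ (0, y₁)`. [folklore] -/
def tE3 : W2 →L[ℝ] W2 := (ContinuousLinearMap.inr ℝ ℂ ℂ).comp (ContinuousLinearMap.fst ℝ ℂ ℂ)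
/-- `y ↦ (0, i y₁)`. [folklore] -/
def tE4 : W2 →L[ℝ] W2 :=
  (ContinuousLinearMap.inr ℝ ℂ ℂ).comp ((ContinuousLinearMap.mul ℝ ℂ I).comp (ContinuousLinearMap.fst ℝ ℂ ℂ))

/-- **The phase field** `(y₁, y₂) ↦ (y₂, p y₂ + q y₁)` as a REAL continuous linear map on `ℂ²`,
written as a real-linear combination of fixed maps (so that smooth dependence on `(p, q)` is
immediate). [folklore] -/
def tA (pc qc : ℂ) : W2 →L[ℝ] W2 := tE0 + pc.re • tE1 + pc.im • tE2 + qc.re • tE3 + qc.im • tE4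

/-- Values of the phase field. [folklore] -/
theorem tA_apply (pc qc : ℂ) (y : W2) : tA pc qc y = (y.2, pc * y.2 + qc * y.1) := by
  have hp : pc * y.2 = (pc.re : ℂ) * y.2 + (pc.im : ℂ) * (I * y.2) := by
    conv_lhs => rw [← Complex.re_add_im pc]
    ring
  have hq : qc * y.1 = (qc.re : ℂ) * y.1 + (qc.im : ℂ) * (I * y.1) := by
    conv_lhs => rw [← Complex.re_add_im qc]
    ring
  ext
  · simp [tA, tE0, tE1, tE2, tE3, tE4]
  · simp [tA, tE0, tE1, tE2, tE3, tE4, hp, hq, Complex.real_smul]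
    ring

/-- The phase field commutes with complex scalars. [folklore] -/
theorem tA_smul (pc qc c : ℂ) (y : W2) : tA pc qc (c • y) = c • tA pc qc y := by
  rw [tA_apply, tA_apply]
  ext
  · simp
  · simp; ring

/-- Smooth dependence of the phase field on the coefficients. [folklore] -/
theorem contDiff_tA {n : WithTop ℕ∞} : ContDiff ℝ n fun c : ℂ × ℂ ↦ tA c.1 c.2 := by
  unfold tA
  have h1 : ContDiff ℝ n fun c : ℂ × ℂ ↦ c.1.re := Complex.reCLM.contDiff.comp contDiff_fst
  have h2 : ContDiff ℝ n fun c : ℂ × ℂ ↦ c.1.im := Complex.imCLM.contDiff.comp contDiff_fst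
  have h3 : ContDiff ℝ n fun c : ℂ × ℂ ↦ c.2.re := Complex.reCLM.contDiff.comp contDiff_snd
  have h4 : ContDiff ℝ n fun c : ℂ × ℂ ↦ c.2.im := Complex.imCLM.contDiff.comp contDiff_snd
  exact (((contDiff_const.add (h1.smul contDiff_const)).add (h2.smul contDiff_const)).add (h3.smul contDiff_const)).add
    (h4.smul contDiff_const)

/-- Smoothness of `x ↦ tA (f x) (g x)` from that of `f`, `g` (composed form; avoids expensive
unification of function composites). [folklore] -/
theorem contDiffOn_tA_comp {E : Type*} [NormedAddCommGroup E] [NormedSpace ℝ E] {n : WithTop ℕ∞} {f g : E → ℂ} {s : Set E}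
    (hf : ContDiffOn ℝ n f s) (hg : ContDiffOn ℝ n g s) : ContDiffOn ℝ n (fun x ↦ tA (f x) (g x)) s := by
  have h1 : ContDiffOn ℝ n (fun x ↦ (f x).re) s := Complex.reCLM.contDiff.comp_contDiffOn hf
  have h2 : ContDiffOn ℝ n (fun x ↦ (f x).im) s := Complex.imCLM.contDiff.comp_contDiffOn hf
  have h3 : ContDiffOn ℝ n (fun x ↦ (g x).re) s := Complex.reCLM.contDiff.comp_contDiffOn hg
  have h4 : ContDiffOn ℝ n (fun x ↦ (g x).im) s := Complex.imCLM.contDiff.comp_contDiffOn hg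
  unfold tA
  exact (((contDiffOn_const.add (h1.smul contDiffOn_const)).add (h2.smul contDiffOn_const)).add (h3.smul contDiffOn_const)).add
    (h4.smul contDiffOn_const)

/-! ### The transport map -/

section Transport

variable {P : Type} [NormedAddCommGroup P] [NormedSpace ℝ P] [CompleteSpace P]

/-- A scalar solution gives an integral curve of the phase field. [folklore] -/
theorem hasDerivAt_phase {pc qc : ℝ → ℂ} {u u' : ℝ → ℂ} {t : ℝ}
    (h : HasDerivAt u (u' t) t ∧ HasDerivAt u' (pc t * u' t + qc t * u t) t) :
    HasDerivAt (fun s ↦ ((u s, u' s) : W2)) (tA (pc t) (qc t) (u t, u' t)) t := by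
  rw [tA_apply]
  exact h.1.prodMk h.2

/-- **Transport of Cauchy data, smooth in parameters.** Let `pc qc : P → ℝ → ℂ` be `Cⁿ`
(`1 ≤ n`) on `U × (ρ₀, ∞)` (`U` open) and `ρ₀ < r₁ < r₂`. There is `Φ : P → ℂ² → ℂ²` with
`(π, d) ↦ Φ π d` of class `Cⁿ` on `U × ℂ²`, `Φ π` additive and `ℂ`-homogeneous, such that every
solution `(u, u')` of `u' = du/dr`, `du'/dr = pc π r · u' + qc π r · u` on `(ρ₀, ∞)` with
`π ∈ U` satisfies `(u r₂, u' r₂) = Φ π (u r₁, u' r₁)`.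
[cite: ShlapentokhRothman2014KleinGordon, App. A] -/
theorem exists_transport {n : ℕ∞} (hn : 1 ≤ n) {pc qc : P → ℝ → ℂ} {U : Set P} (hU : IsOpen U) {ρ₀ r₁ r₂ : ℝ}
    (h₀ : ρ₀ < r₁) (h₁₂ : r₁ < r₂)
    (hp : ContDiffOn ℝ n (fun x : P × ℝ ↦ pc x.1 x.2) (U ×ˢ Ioi ρ₀))
    (hq : ContDiffOn ℝ n (fun x : P × ℝ ↦ qc x.1 x.2) (U ×ˢ Ioi ρ₀)) :
    ∃ Φ : P → W2 → W2,
      ContDiffOn ℝ n (fun x : P × W2 ↦ Φ x.1 x.2) (U ×ˢ univ) ∧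
      (∀ π ∈ U, ∀ d e : W2, Φ π (d + e) = Φ π d + Φ π e) ∧
      (∀ π ∈ U, ∀ (c : ℂ) (d : W2), Φ π (c • d) = c • Φ π d) ∧
      ∀ π ∈ U, ∀ u u' : ℝ → ℂ,
        (∀ r ∈ Ioi ρ₀, HasDerivAt u (u' r) r ∧ HasDerivAt u' (pc π r * u' r + qc π r * u r) r) →
        ((u r₂, u' r₂) : W2) = Φ π (u r₁, u' r₁) := by
  -- time origin at the midpoint
  set rm : ℝ := (r₁ + r₂) / 2 with hrm
  set T : ℝ := rm - ρ₀ with hT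
  set τ : ℝ := (r₂ - r₁) / 2 with hτ
  set T' : ℝ := (τ + T) / 2 with hT'
  have hτ0 : 0 < τ := by rw [hτ]; linarith
  have hτT : τ < T := by rw [hτ, hT, hrm]; linarith
  have hT'0 : 0 < T' := by rw [hT']; linarith
  have hT'T : T' < T := by rw [hT']; linarith
  have hτT' : τ < T' := by rw [hT']; linarith
  have ht₁ : -τ ∈ Ioo (-T') T' := ⟨by linarith, by linarith⟩
  have ht₂ : τ ∈ Ioo (-T') T' := ⟨by linarith, by linarith⟩
  have hr₁ : rm + -τ = r₁ := by rw [hrm, hτ]; ring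
  have hr₂ : rm + τ = r₂ := by rw [hrm, hτ]; ring
  -- the field `A π t = tA (pc π (rm + t)) (qc π (rm + t))`
  obtain ⟨A, hA_def⟩ : ∃ A : P → ℝ → W2 →L[ℝ] W2, A = fun π t ↦ tA (pc π (rm + t)) (qc π (rm + t)) := ⟨_, rfl⟩
  have hshift : ∀ x : P × ℝ, x ∈ U ×ˢ Ioo (-T) T → (x.1, rm + x.2) ∈ U ×ˢ Ioi ρ₀ := fun x hx ↦
    ⟨hx.1, by simp only [mem_Ioi]; rw [hT] at hx; linarith [hx.2.1]⟩
  have hA : ContDiffOn ℝ n (fun x : P × ℝ ↦ A x.1 x.2) (U ×ˢ Ioo (-T) T) := by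
    have hsh : ContDiff ℝ n (fun x : P × ℝ ↦ ((x.1, rm + x.2) : P × ℝ)) := contDiff_fst.prodMk (contDiff_const.add contDiff_snd)
    have hp' : ContDiffOn ℝ n (fun x : P × ℝ ↦ pc x.1 (rm + x.2)) (U ×ˢ Ioo (-T) T) := hp.comp hsh.contDiffOn hshift
    have hq' : ContDiffOn ℝ n (fun x : P × ℝ ↦ qc x.1 (rm + x.2)) (U ×ˢ Ioo (-T) T) := hq.comp hsh.contDiffOn hshift
    have h : ContDiffOn ℝ n (fun x : P × ℝ ↦ tA (pc x.1 (rm + x.2)) (qc x.1 (rm + x.2))) (U ×ˢ Ioo (-T) T) :=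
      contDiffOn_tA_comp hp' hq'
    rw [hA_def]
    exact h
  -- a fundamental pair of solutions, smooth in `(π, t)`
  have hn' : (1 : ℕ∞) ≤ n := hn
  obtain ⟨u1, hu1_0, hu1_d, hu1_s⟩ := exists_contDiffOn_linearODE_param (A := A) hn' hU hT'0 hT'T hA ((1, 0) : W2)
  obtain ⟨u2, hu2_0, hu2_d, hu2_s⟩ := exists_contDiffOn_linearODE_param (A := A) hn' hU hT'0 hT'T hA ((0, 1) : W2)
  -- continuity of `A π` on the time interval (for uniqueness)
  have hAcont : ∀ π ∈ U, ContinuousOn (A π) (Ioo (-T') T') := fun π hπ ↦ by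
    have h1 : ContinuousOn (fun x : P × ℝ ↦ A x.1 x.2) (U ×ˢ Ioo (-T) T) := hA.continuousOn
    have h2 : ContinuousOn (fun t : ℝ ↦ ((π, t) : P × ℝ)) (Ioo (-T') T') := (continuous_const.prodMk continuous_id).continuousOn
    exact h1.comp h2 fun t ht ↦ ⟨hπ, ⟨by linarith [ht.1], by linarith [ht.2]⟩⟩
  -- linear combinations of the fundamental pair are solutions
  have hcomb : ∀ π ∈ U, ∀ c₁ c₂ : ℂ, ∀ t ∈ Ioo (-T') T',
      HasDerivAt (fun s ↦ c₁ • u1 π s + c₂ • u2 π s) (A π t (c₁ • u1 π t + c₂ • u2 π t)) t := by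
    intro π hπ c₁ c₂ t ht
    have h := ((hu1_d π hπ t ht).const_smul c₁).add ((hu2_d π hπ t ht).const_smul c₂)
    refine h.congr_deriv ?_
    simp only [hA_def, map_add, tA_smul]
  -- the connection matrix at `t₁ = -τ` is invertible
  set det : P → ℂ := fun π ↦ (u1 π (-τ)).1 * (u2 π (-τ)).2 - (u1 π (-τ)).2 * (u2 π (-τ)).1 with hdet
  have hdet_ne : ∀ π ∈ U, det π ≠ 0 := by
    intro π hπ hzero
    simp only [hdet] at hzero
    set v := u1 π (-τ) with hv
    set w := u2 π (-τ) with hw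
    -- a non-trivial kernel vector `(c₁, c₂)` of the matrix with columns `v`, `w`
    obtain ⟨c₁, c₂, hc, hk1, hk2⟩ : ∃ c₁ c₂ : ℂ, (c₁ ≠ 0 ∨ c₂ ≠ 0) ∧
        c₁ * v.1 + c₂ * w.1 = 0 ∧ c₁ * v.2 + c₂ * w.2 = 0 := by
      by_cases hA : v.1 = 0 ∧ w.1 = 0
      · by_cases hB : v.2 = 0 ∧ w.2 = 0
        · exact ⟨1, 0, Or.inl one_ne_zero, by simp [hA.1], by simp [hB.1]⟩
        · refine ⟨w.2, -v.2, ?_, by rw [hA.1, hA.2]; ring, by ring⟩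
          by_contra h
          push Not at h
          exact hB ⟨by linear_combination -h.2, h.1⟩
      · refine ⟨w.1, -v.1, ?_, by ring, by linear_combination -hzero⟩
        by_contra h
        push Not at h
        exact hA ⟨by linear_combination -h.2, h.1⟩
    -- the corresponding combination vanishes at `-τ`, hence identically, hence at `0`
    set Y : ℝ → W2 := fun t ↦ c₁ • u1 π t + c₂ • u2 π t with hY
    have hYsol : ∀ t ∈ Ioo (-T') T', HasDerivAt Y (A π t (Y t)) t := fun t ht ↦ hcomb π hπ c₁ c₂ t ht
    have hZsol : ∀ t ∈ Ioo (-T') T', HasDerivAt (fun _ : ℝ ↦ (0 : W2)) (A π t ((fun _ : ℝ ↦ (0 : W2)) t)) t := fun t _ ↦ by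
      simpa using hasDerivAt_const t (0 : W2)
    have hY1 : Y (-τ) = 0 := by
      simp only [hY, ← hv, ← hw]
      ext <;> simp [hk1, hk2]
    have hEq := eqOn_of_hasDerivAt_linear ht₁ (hAcont π hπ) hYsol hZsol hY1
    have h0 : Y 0 = 0 := hEq ⟨by linarith, by linarith⟩
    simp only [hY, hu1_0 π hπ, hu2_0 π hπ] at h0
    have e1 : c₁ = 0 := by simpa using congrArg Prod.fst h0
    have e2 : c₂ = 0 := by simpa using congrArg Prod.snd h0
    rcases hc with h | h
    · exact h e1
    · exact h e2
  -- the transport map by Cramer's rule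
  set Φ : P → W2 → W2 := fun π d ↦
    ((d.1 * (u2 π (-τ)).2 - d.2 * (u2 π (-τ)).1) / det π) • u1 π τ +
      (((u1 π (-τ)).1 * d.2 - (u1 π (-τ)).2 * d.1) / det π) • u2 π τ with hΦ
  refine ⟨Φ, ?_, ?_, ?_, ?_⟩
  · -- smoothness on `U × ℂ²`
    have hev : ∀ (i : P → ℝ → W2), ContDiffOn ℝ n (fun q : P × ℝ ↦ i q.1 q.2) (U ×ˢ Ioo (-T') T') →
        ∀ t₀ ∈ Ioo (-T') T', ContDiffOn ℝ n (fun x : P × W2 ↦ i x.1 t₀) (U ×ˢ (univ : Set W2)) := by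
      intro i hi t₀ ht₀
      have hmap : ContDiff ℝ n (fun x : P × W2 ↦ ((x.1, t₀) : P × ℝ)) := contDiff_fst.prodMk contDiff_const
      exact hi.comp hmap.contDiffOn fun x hx ↦ ⟨hx.1, ht₀⟩
    have g1p := hev u1 hu1_s τ ht₂
    have g2p := hev u2 hu2_s τ ht₂
    have g1m := hev u1 hu1_s (-τ) ht₁
    have g2m := hev u2 hu2_s (-τ) ht₁
    have c1 : ContDiffOn ℝ n (fun x : P × W2 ↦ (u1 x.1 (-τ)).1) (U ×ˢ univ) := contDiff_fst.comp_contDiffOn g1m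
    have c2 : ContDiffOn ℝ n (fun x : P × W2 ↦ (u1 x.1 (-τ)).2) (U ×ˢ univ) := contDiff_snd.comp_contDiffOn g1m
    have c3 : ContDiffOn ℝ n (fun x : P × W2 ↦ (u2 x.1 (-τ)).1) (U ×ˢ univ) := contDiff_fst.comp_contDiffOn g2m
    have c4 : ContDiffOn ℝ n (fun x : P × W2 ↦ (u2 x.1 (-τ)).2) (U ×ˢ univ) := contDiff_snd.comp_contDiffOn g2m
    have d1 : ContDiffOn ℝ n (fun x : P × W2 ↦ x.2.1) (U ×ˢ univ) := (contDiff_fst.comp contDiff_snd).contDiffOn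
    have d2 : ContDiffOn ℝ n (fun x : P × W2 ↦ x.2.2) (U ×ˢ univ) := (contDiff_snd.comp contDiff_snd).contDiffOn
    have hdetS : ContDiffOn ℝ n (fun x : P × W2 ↦ det x.1) (U ×ˢ univ) := (c1.mul c4).sub (c2.mul c3)
    have hdetI : ContDiffOn ℝ n (fun x : P × W2 ↦ (det x.1)⁻¹) (U ×ˢ univ) := hdetS.inv fun x hx ↦ hdet_ne x.1 hx.1
    have k1 : ContDiffOn ℝ n (fun x : P × W2 ↦ (x.2.1 * (u2 x.1 (-τ)).2 - x.2.2 * (u2 x.1 (-τ)).1) / det x.1) (U ×ˢ univ) := by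
      have := ((d1.mul c4).sub (d2.mul c3)).mul hdetI
      exact this.congr fun x _ ↦ by rw [div_eq_mul_inv]
    have k2 : ContDiffOn ℝ n (fun x : P × W2 ↦ ((u1 x.1 (-τ)).1 * x.2.2 - (u1 x.1 (-τ)).2 * x.2.1) / det x.1) (U ×ˢ univ) := by
      have := ((c1.mul d2).sub (c2.mul d1)).mul hdetI
      exact this.congr fun x _ ↦ by rw [div_eq_mul_inv]
    exact (k1.smul g1p).add (k2.smul g2p)
  · -- additivity
    intro π _ d e
    simp only [hΦ, Prod.fst_add, Prod.snd_add]
    rw [show (d.1 + e.1) * (u2 π (-τ)).2 - (d.2 + e.2) * (u2 π (-τ)).1 =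
        (d.1 * (u2 π (-τ)).2 - d.2 * (u2 π (-τ)).1) + (e.1 * (u2 π (-τ)).2 - e.2 * (u2 π (-τ)).1) by ring,
      show (u1 π (-τ)).1 * (d.2 + e.2) - (u1 π (-τ)).2 * (d.1 + e.1) =
        ((u1 π (-τ)).1 * d.2 - (u1 π (-τ)).2 * d.1) + ((u1 π (-τ)).1 * e.2 - (u1 π (-τ)).2 * e.1) by ring,
      add_div, add_div, add_smul, add_smul]
    abel
  · -- homogeneity
    intro π _ c d
    simp only [hΦ, Prod.smul_fst, Prod.smul_snd, smul_eq_mul, smul_add, smul_smul]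
    congr 1 <;> congr 1 <;> ring
  · -- the transport property
    intro π hπ u u' hsol
    -- the phase curve of `u` in the shifted time
    set Yu : ℝ → W2 := fun t ↦ (u (rm + t), u' (rm + t)) with hYu
    have hYu_sol : ∀ t ∈ Ioo (-T') T', HasDerivAt Yu (A π t (Yu t)) t := by
      intro t ht
      have hrt : rm + t ∈ Ioi ρ₀ := by simp only [mem_Ioi]; rw [hT] at hT'T; linarith [ht.1]
      have h := hasDerivAt_phase (pc := pc π) (qc := qc π) (hsol (rm + t) hrt)
      -- chain rule with `s ↦ rm + s`
      have hsh : HasDerivAt (fun s : ℝ ↦ rm + s) 1 t := (hasDerivAt_id t).const_add rm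
      have hc := h.scomp t hsh
      simp only [one_smul] at hc
      rw [hA_def]
      exact hc
    -- the matching combination
    set d : W2 := Yu (-τ) with hd
    set c₁ : ℂ := (d.1 * (u2 π (-τ)).2 - d.2 * (u2 π (-τ)).1) / det π with hc₁
    set c₂ : ℂ := ((u1 π (-τ)).1 * d.2 - (u1 π (-τ)).2 * d.1) / det π with hc₂
    set Z : ℝ → W2 := fun t ↦ c₁ • u1 π t + c₂ • u2 π t with hZ
    have hZsol : ∀ t ∈ Ioo (-T') T', HasDerivAt Z (A π t (Z t)) t := fun t ht ↦ hcomb π hπ c₁ c₂ t ht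
    have hZ1 : Z (-τ) = d := by
      have hD := hdet_ne π hπ
      simp only [hZ, hc₁, hc₂]
      ext
      · simp only [Prod.fst_add, Prod.smul_fst, smul_eq_mul]
        field_simp
        simp only [hdet]
        ring
      · simp only [Prod.snd_add, Prod.smul_snd, smul_eq_mul]
        field_simp
        simp only [hdet]
        ring
    have hEq := eqOn_of_hasDerivAt_linear ht₁ (hAcont π hπ) hZsol hYu_sol (hZ1.trans hd)
    have h2 := hEq ht₂
    -- read off at `t₂ = τ`
    have hYu2 : Yu τ = (u r₂, u' r₂) := by simp only [hYu, hr₂]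
    have hd1 : d = (u r₁, u' r₁) := by simp only [hd, hYu, hr₁]
    rw [← hYu2, ← h2]
    simp only [hZ, hΦ, hc₁, hc₂, hd1]

/-- **Transport of Cauchy data, jointly smooth in the parameter AND the target radius.** Same
setting as `exists_transport`; the conclusion is a family `Ψ π t` of transport maps from the datum
at `r₁` to the datum at `t`, for all `t` in an open interval `(r₁ − ε, r₂ + ε)`, with
`(π, t, d) ↦ Ψ π t d` of class `Cⁿ` on `U × (r₁ − ε, r₂ + ε) × ℂ²` — in particular the solution
values are jointly continuous in (parameter, radius), as needed by shooting arguments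
(`HalfLineShooting.exists_boundState_of_sup_oscillation`). [cite: ShlapentokhRothman2014KleinGordon, App. A] -/
theorem exists_transport_joint {n : ℕ∞} (hn : 1 ≤ n) {pc qc : P → ℝ → ℂ} {U : Set P} (hU : IsOpen U) {ρ₀ r₁ r₂ : ℝ}
    (h₀ : ρ₀ < r₁) (h₁₂ : r₁ < r₂)
    (hp : ContDiffOn ℝ n (fun x : P × ℝ ↦ pc x.1 x.2) (U ×ˢ Ioi ρ₀))
    (hq : ContDiffOn ℝ n (fun x : P × ℝ ↦ qc x.1 x.2) (U ×ˢ Ioi ρ₀)) :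
    ∃ Ψ : P → ℝ → W2 → W2, ∃ ε > (0 : ℝ),
      ContDiffOn ℝ n (fun x : P × ℝ × W2 ↦ Ψ x.1 x.2.1 x.2.2) (U ×ˢ (Ioo (r₁ - ε) (r₂ + ε) ×ˢ univ)) ∧
      ∀ π ∈ U, ∀ u u' : ℝ → ℂ,
        (∀ r ∈ Ioi ρ₀, HasDerivAt u (u' r) r ∧ HasDerivAt u' (pc π r * u' r + qc π r * u r) r) →
        ∀ t ∈ Ioo (r₁ - ε) (r₂ + ε), ((u t, u' t) : W2) = Ψ π t (u r₁, u' r₁) := by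
  -- time origin at the midpoint
  set rm : ℝ := (r₁ + r₂) / 2 with hrm
  set T : ℝ := rm - ρ₀ with hT
  set τ : ℝ := (r₂ - r₁) / 2 with hτ
  set T' : ℝ := (τ + T) / 2 with hT'
  have hτ0 : 0 < τ := by rw [hτ]; linarith
  have hτT : τ < T := by rw [hτ, hT, hrm]; linarith
  have hT'0 : 0 < T' := by rw [hT']; linarith
  have hT'T : T' < T := by rw [hT']; linarith
  have hτT' : τ < T' := by rw [hT']; linarith
  have ht₁ : -τ ∈ Ioo (-T') T' := ⟨by linarith, by linarith⟩
  have ht₂ : τ ∈ Ioo (-T') T' := ⟨by linarith, by linarith⟩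
  have hr₁ : rm + -τ = r₁ := by rw [hrm, hτ]; ring
  have hr₂ : rm + τ = r₂ := by rw [hrm, hτ]; ring
  -- the field `A π t = tA (pc π (rm + t)) (qc π (rm + t))`
  obtain ⟨A, hA_def⟩ : ∃ A : P → ℝ → W2 →L[ℝ] W2, A = fun π t ↦ tA (pc π (rm + t)) (qc π (rm + t)) := ⟨_, rfl⟩
  have hshift : ∀ x : P × ℝ, x ∈ U ×ˢ Ioo (-T) T → (x.1, rm + x.2) ∈ U ×ˢ Ioi ρ₀ := fun x hx ↦
    ⟨hx.1, by simp only [mem_Ioi]; rw [hT] at hx; linarith [hx.2.1]⟩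
  have hA : ContDiffOn ℝ n (fun x : P × ℝ ↦ A x.1 x.2) (U ×ˢ Ioo (-T) T) := by
    have hsh : ContDiff ℝ n (fun x : P × ℝ ↦ ((x.1, rm + x.2) : P × ℝ)) := contDiff_fst.prodMk (contDiff_const.add contDiff_snd)
    have hp' : ContDiffOn ℝ n (fun x : P × ℝ ↦ pc x.1 (rm + x.2)) (U ×ˢ Ioo (-T) T) := hp.comp hsh.contDiffOn hshift
    have hq' : ContDiffOn ℝ n (fun x : P × ℝ ↦ qc x.1 (rm + x.2)) (U ×ˢ Ioo (-T) T) := hq.comp hsh.contDiffOn hshift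
    have h : ContDiffOn ℝ n (fun x : P × ℝ ↦ tA (pc x.1 (rm + x.2)) (qc x.1 (rm + x.2))) (U ×ˢ Ioo (-T) T) :=
      contDiffOn_tA_comp hp' hq'
    rw [hA_def]
    exact h
  -- a fundamental pair of solutions, smooth in `(π, t)`
  have hn' : (1 : ℕ∞) ≤ n := hn
  obtain ⟨u1, hu1_0, hu1_d, hu1_s⟩ := exists_contDiffOn_linearODE_param (A := A) hn' hU hT'0 hT'T hA ((1, 0) : W2)
  obtain ⟨u2, hu2_0, hu2_d, hu2_s⟩ := exists_contDiffOn_linearODE_param (A := A) hn' hU hT'0 hT'T hA ((0, 1) : W2)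
  -- continuity of `A π` on the time interval (for uniqueness)
  have hAcont : ∀ π ∈ U, ContinuousOn (A π) (Ioo (-T') T') := fun π hπ ↦ by
    have h1 : ContinuousOn (fun x : P × ℝ ↦ A x.1 x.2) (U ×ˢ Ioo (-T) T) := hA.continuousOn
    have h2 : ContinuousOn (fun t : ℝ ↦ ((π, t) : P × ℝ)) (Ioo (-T') T') := (continuous_const.prodMk continuous_id).continuousOn
    exact h1.comp h2 fun t ht ↦ ⟨hπ, ⟨by linarith [ht.1], by linarith [ht.2]⟩⟩
  -- linear combinations of the fundamental pair are solutions
  have hcomb : ∀ π ∈ U, ∀ c₁ c₂ : ℂ, ∀ t ∈ Ioo (-T') T',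
      HasDerivAt (fun s ↦ c₁ • u1 π s + c₂ • u2 π s) (A π t (c₁ • u1 π t + c₂ • u2 π t)) t := by
    intro π hπ c₁ c₂ t ht
    have h := ((hu1_d π hπ t ht).const_smul c₁).add ((hu2_d π hπ t ht).const_smul c₂)
    refine h.congr_deriv ?_
    simp only [hA_def, map_add, tA_smul]
  -- the connection matrix at `t₁ = -τ` is invertible
  set det : P → ℂ := fun π ↦ (u1 π (-τ)).1 * (u2 π (-τ)).2 - (u1 π (-τ)).2 * (u2 π (-τ)).1 with hdet
  have hdet_ne : ∀ π ∈ U, det π ≠ 0 := by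
    intro π hπ hzero
    simp only [hdet] at hzero
    set v := u1 π (-τ) with hv
    set w := u2 π (-τ) with hw
    -- a non-trivial kernel vector `(c₁, c₂)` of the matrix with columns `v`, `w`
    obtain ⟨c₁, c₂, hc, hk1, hk2⟩ : ∃ c₁ c₂ : ℂ, (c₁ ≠ 0 ∨ c₂ ≠ 0) ∧
        c₁ * v.1 + c₂ * w.1 = 0 ∧ c₁ * v.2 + c₂ * w.2 = 0 := by
      by_cases hA : v.1 = 0 ∧ w.1 = 0
      · by_cases hB : v.2 = 0 ∧ w.2 = 0
        · exact ⟨1, 0, Or.inl one_ne_zero, by simp [hA.1], by simp [hB.1]⟩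
        · refine ⟨w.2, -v.2, ?_, by rw [hA.1, hA.2]; ring, by ring⟩
          by_contra h
          push Not at h
          exact hB ⟨by linear_combination -h.2, h.1⟩
      · refine ⟨w.1, -v.1, ?_, by ring, by linear_combination -hzero⟩
        by_contra h
        push Not at h
        exact hA ⟨by linear_combination -h.2, h.1⟩
    -- the corresponding combination vanishes at `-τ`, hence identically, hence at `0`
    set Y : ℝ → W2 := fun t ↦ c₁ • u1 π t + c₂ • u2 π t with hY
    have hYsol : ∀ t ∈ Ioo (-T') T', HasDerivAt Y (A π t (Y t)) t := fun t ht ↦ hcomb π hπ c₁ c₂ t ht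
    have hZsol : ∀ t ∈ Ioo (-T') T', HasDerivAt (fun _ : ℝ ↦ (0 : W2)) (A π t ((fun _ : ℝ ↦ (0 : W2)) t)) t := fun t _ ↦ by
      simpa using hasDerivAt_const t (0 : W2)
    have hY1 : Y (-τ) = 0 := by
      simp only [hY, ← hv, ← hw]
      ext <;> simp [hk1, hk2]
    have hEq := eqOn_of_hasDerivAt_linear ht₁ (hAcont π hπ) hYsol hZsol hY1
    have h0 : Y 0 = 0 := hEq ⟨by linarith, by linarith⟩
    simp only [hY, hu1_0 π hπ, hu2_0 π hπ] at h0
    have e1 : c₁ = 0 := by simpa using congrArg Prod.fst h0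
    have e2 : c₂ = 0 := by simpa using congrArg Prod.snd h0
    rcases hc with h | h
    · exact h e1
    · exact h e2
  -- the transport maps by Cramer's rule, for all shifted times
  set Ψ : P → ℝ → W2 → W2 := fun π t d ↦
    ((d.1 * (u2 π (-τ)).2 - d.2 * (u2 π (-τ)).1) / det π) • u1 π (t - rm) +
      (((u1 π (-τ)).1 * d.2 - (u1 π (-τ)).2 * d.1) / det π) • u2 π (t - rm) with hΨ
  have hε : 0 < T' - τ := by linarith
  have hI : ∀ t ∈ Ioo (r₁ - (T' - τ)) (r₂ + (T' - τ)), t - rm ∈ Ioo (-T') T' := by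
    intro t ht
    constructor
    · have := ht.1; rw [← hr₁] at this; linarith
    · have := ht.2; rw [← hr₂] at this; linarith
  refine ⟨Ψ, T' - τ, hε, ?_, ?_⟩
  · -- joint smoothness on `U × (r₁ - ε, r₂ + ε) × ℂ²`
    set S : Set (P × ℝ × W2) := U ×ˢ (Ioo (r₁ - (T' - τ)) (r₂ + (T' - τ)) ×ˢ (univ : Set W2)) with hS
    have hevT : ∀ (i : P → ℝ → W2), ContDiffOn ℝ n (fun q : P × ℝ ↦ i q.1 q.2) (U ×ˢ Ioo (-T') T') →
        ContDiffOn ℝ n (fun x : P × ℝ × W2 ↦ i x.1 (x.2.1 - rm)) S := by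
      intro i hi
      have hmap : ContDiff ℝ n (fun x : P × ℝ × W2 ↦ ((x.1, x.2.1 - rm) : P × ℝ)) :=
        contDiff_fst.prodMk ((contDiff_fst.comp contDiff_snd).sub contDiff_const)
      exact hi.comp hmap.contDiffOn fun x hx ↦ ⟨hx.1, hI x.2.1 hx.2.1⟩
    have hev0 : ∀ (i : P → ℝ → W2), ContDiffOn ℝ n (fun q : P × ℝ ↦ i q.1 q.2) (U ×ˢ Ioo (-T') T') →
        ∀ t₀ ∈ Ioo (-T') T', ContDiffOn ℝ n (fun x : P × ℝ × W2 ↦ i x.1 t₀) S := by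
      intro i hi t₀ ht₀
      have hmap : ContDiff ℝ n (fun x : P × ℝ × W2 ↦ ((x.1, t₀) : P × ℝ)) := contDiff_fst.prodMk contDiff_const
      exact hi.comp hmap.contDiffOn fun x hx ↦ ⟨hx.1, ht₀⟩
    have g1 := hevT u1 hu1_s
    have g2 := hevT u2 hu2_s
    have g1m := hev0 u1 hu1_s (-τ) ht₁
    have g2m := hev0 u2 hu2_s (-τ) ht₁
    have c1 : ContDiffOn ℝ n (fun x : P × ℝ × W2 ↦ (u1 x.1 (-τ)).1) S := contDiff_fst.comp_contDiffOn g1m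
    have c2 : ContDiffOn ℝ n (fun x : P × ℝ × W2 ↦ (u1 x.1 (-τ)).2) S := contDiff_snd.comp_contDiffOn g1m
    have c3 : ContDiffOn ℝ n (fun x : P × ℝ × W2 ↦ (u2 x.1 (-τ)).1) S := contDiff_fst.comp_contDiffOn g2m
    have c4 : ContDiffOn ℝ n (fun x : P × ℝ × W2 ↦ (u2 x.1 (-τ)).2) S := contDiff_snd.comp_contDiffOn g2m
    have d1 : ContDiffOn ℝ n (fun x : P × ℝ × W2 ↦ x.2.2.1) S := (contDiff_fst.comp (contDiff_snd.comp contDiff_snd)).contDiffOn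
    have d2 : ContDiffOn ℝ n (fun x : P × ℝ × W2 ↦ x.2.2.2) S := (contDiff_snd.comp (contDiff_snd.comp contDiff_snd)).contDiffOn
    have hdetS : ContDiffOn ℝ n (fun x : P × ℝ × W2 ↦ det x.1) S := (c1.mul c4).sub (c2.mul c3)
    have hdetI : ContDiffOn ℝ n (fun x : P × ℝ × W2 ↦ (det x.1)⁻¹) S := hdetS.inv fun x hx ↦ hdet_ne x.1 hx.1
    have k1 : ContDiffOn ℝ n (fun x : P × ℝ × W2 ↦ (x.2.2.1 * (u2 x.1 (-τ)).2 - x.2.2.2 * (u2 x.1 (-τ)).1) / det x.1) S := by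
      have := ((d1.mul c4).sub (d2.mul c3)).mul hdetI
      exact this.congr fun x _ ↦ by rw [div_eq_mul_inv]
    have k2 : ContDiffOn ℝ n (fun x : P × ℝ × W2 ↦ ((u1 x.1 (-τ)).1 * x.2.2.2 - (u1 x.1 (-τ)).2 * x.2.2.1) / det x.1) S := by
      have := ((c1.mul d2).sub (c2.mul d1)).mul hdetI
      exact this.congr fun x _ ↦ by rw [div_eq_mul_inv]
    exact (k1.smul g1).add (k2.smul g2)
  · -- the transport property at every `t`
    intro π hπ u u' hsol t ht
    set Yu : ℝ → W2 := fun s ↦ (u (rm + s), u' (rm + s)) with hYu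
    have hYu_sol : ∀ s ∈ Ioo (-T') T', HasDerivAt Yu (A π s (Yu s)) s := by
      intro s hs
      have hrt : rm + s ∈ Ioi ρ₀ := by simp only [mem_Ioi]; rw [hT] at hT'T; linarith [hs.1]
      have h := hasDerivAt_phase (pc := pc π) (qc := qc π) (hsol (rm + s) hrt)
      have hsh : HasDerivAt (fun s : ℝ ↦ rm + s) 1 s := (hasDerivAt_id s).const_add rm
      have hc := h.scomp s hsh
      simp only [one_smul] at hc
      rw [hA_def]
      exact hc
    set d : W2 := Yu (-τ) with hd
    set c₁ : ℂ := (d.1 * (u2 π (-τ)).2 - d.2 * (u2 π (-τ)).1) / det π with hc₁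
    set c₂ : ℂ := ((u1 π (-τ)).1 * d.2 - (u1 π (-τ)).2 * d.1) / det π with hc₂
    set Z : ℝ → W2 := fun s ↦ c₁ • u1 π s + c₂ • u2 π s with hZ
    have hZsol : ∀ s ∈ Ioo (-T') T', HasDerivAt Z (A π s (Z s)) s := fun s hs ↦ hcomb π hπ c₁ c₂ s hs
    have hZ1 : Z (-τ) = d := by
      have hD := hdet_ne π hπ
      simp only [hZ, hc₁, hc₂]
      ext
      · simp only [Prod.fst_add, Prod.smul_fst, smul_eq_mul]
        field_simp
        simp only [hdet]
        ring
      · simp only [Prod.snd_add, Prod.smul_snd, smul_eq_mul]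
        field_simp
        simp only [hdet]
        ring
    have hEq := eqOn_of_hasDerivAt_linear ht₁ (hAcont π hπ) hZsol hYu_sol (hZ1.trans hd)
    have h2 := hEq (hI t ht)
    have hYut : Yu (t - rm) = (u t, u' t) := by simp only [hYu]; ring_nf
    have hd1 : d = (u r₁, u' r₁) := by simp only [hd, hYu, hr₁]
    rw [← hYut, ← h2]
    simp only [hZ, hΨ, hc₁, hc₂, hd1]

end Transport


end Literature.Analysis.ODE

end
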